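import Literature.NumberTheory.EllipticCurves.ComplexMultiplicationBSDTripleTableProofs
import Literature.NumberTheory.EllipticCurves.ComplexMultiplicationBSDTripleIsogenyProofs
import Literature.NumberTheory.EllipticCurves.ComplexMultiplicationMaximalOrderLeavesProofs
import Literature.NumberTheory.EllipticCurves.ComplexMultiplicationBurungaleFlachMainKatoProofs
import HarnessLib

/-!
# bsd.S28 (geometric-CM form) after the class number one theorem: two leaves

A further sibling proof file (theorems only — no definition, no named fact, nothing restated) of
`Literature.NumberTheory.EllipticCurves.ComplexMultiplication` for its named fact
`Literature.NumberTheory.EllipticCurves.bsdTriple_of_hasCM_of_L_one_ne_zero` (**bsd.S28**, the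
Birch–Swinnerton-Dyer statement `W.BSDTriple` for a globally minimal `W/ℚ` with *geometric*
complex multiplication and `L(E,1) ≠ 0`; Burungale–Flach, *Camb. J. Math.* 12 (2024), Cor. 2 and
the sentence following its proof, arXiv:2206.09874 p. 4: *"Any CM elliptic curve `E/ℚ` with
`L(E/ℚ,1) ≠ 0` satisfies the assumptions of Corollary 2"*), after
`ComplexMultiplicationBSDTripleProofs.lean` (four printed leaves),
`ComplexMultiplicationBSDTripleCasselsProofs.lean` (Cassels' quotient form),
`ComplexMultiplicationBSDTriple{Rank,Isogeny}Proofs.lean` (the truth form of Milne's I.7.3) and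
`ComplexMultiplicationBSDTripleTableProofs.lean` (three leaves: Corollary 2 over `ℚ` as printed
`BurungaleFlach2024_bsd_rat`, the `only if` half of the CM classification
`j_mem_cmJInvariants_of_hasCM`, and Cassels' isogeny invariance of the BSD quotient
`WeierstrassCurve.bsdRHS_eq_of_isIsogenous`).

Since then the class number one theorem (Heegner–Stark–Baker) has become a theorem of the tree
(`HeegnerStarkPrimeThreeModEight_holds`, `QuadraticFields/ClassNumberOneLandauProofs.lean`, by
Baker's route), and with it

* `j_mem_cmJInvariants_of_hasCM` (`j_mem_cmJInvariants_of_hasCM_of_heegnerStarkPrime`,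
  `ComplexMultiplicationHasCMHeegnerStarkProofs.lean`, at `HeegnerStarkPrimeThreeModEight_holds`;
  named `j_mem_cmJInvariants_of_hasCM_holds` in `ComplexMultiplicationHasCMIffHoldsProofs.lean`),
* `exists_isIsogenous_j_mem_maximalCMJInvariants_of_hasCM_holds` (Silverman *AT* Ex. 2.12(b);
  `ComplexMultiplicationMaximalOrderLeavesProofs.lean`),
* `hasCM_of_j_mem_maximalCMJInvariants_holds` (`ComplexMultiplicationHasCMIffProofs.lean`),

while Knapp's Thm. 11.67 is `LFunction_eq_of_isIsogenous_holds`
(`ComplexMultiplicationLFunctionIsogenyHoldsProofs.lean`) and the truth form of Milne's Thm. I.7.3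
is reduced to the bare quotient fact
(`WeierstrassCurve.bsdTriple_iff_of_isIsogenous_of_bsdRHS_eq_of_isIsogenous`,
`ComplexMultiplicationBSDTripleIsogenyProofs.lean`). This file records the consequence — the
whole "CM ⟹ CM by `𝓞_K` up to `ℚ`-isogeny" layer of the paper's sentence is now proved, and the
geometric-CM form of bsd.S28 sits on exactly **two** named facts:

* `bsdTriple_of_hasCM_of_L_one_ne_zero_of_maximal_of_bsdRHS_eq_of_isIsogenous` (**proved**):
  from the verbatim form `bsdTriple_of_j_mem_maximalCMJInvariants_of_L_one_ne_zero` (CM by the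
  maximal order, the paper's standing convention, §1) and Cassels' quotient invariance;
* `bsdTriple_of_hasCM_of_L_one_ne_zero_iff_maximal_of_bsdRHS_eq_of_isIsogenous` (**proved**):
  modulo Cassels' theorem alone the two forms of bsd.S28 are **equivalent**;
* `bsdTriple_of_hasCM_of_L_one_ne_zero_of_BurungaleFlach2024_of_bsdRHS_eq_of_isIsogenous`
  (**proved**): from Corollary 2 over `ℚ` as printed (`BurungaleFlach2024_bsd_rat`) and Cassels —
  the shape of the eventual discharge
  `bsdTriple_of_hasCM_of_L_one_ne_zero_holds := … BurungaleFlach2024_bsd_rat_holds bsdRHS_eq_of_isIsogenous_holds`;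
* `bsdTriple_of_hasCM_of_L_one_ne_zero_of_pPart_of_Kato` (**proved**): from the five primary
  leaves below Corollary 2 over `ℚ` in the tree
  (`bsdTriple_of_j_mem_maximalCMJInvariants_of_L_one_ne_zero_of_pPart_of_Kato`,
  `ComplexMultiplicationBurungaleFlachMainKatoProofs.lean`): the paper's own Prop. 2.3 with
  Lemma 13 at `F = K` for every `p` (`BurungaleFlach2024_main_cmField_pPart`: two-variable main
  conjecture and the reciprocity law), Kato's finiteness theorem over `ℚ`
  (`kato_finite_of_L_one_ne_zero`), Milne 1972 Thm. 1 in rank zero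
  (`bsdRHS_baseChange_quadratic`), Cassels (`bsdRHS_eq_of_isIsogenous`) and `L(E,1) ≥ 0`
  (`re_entireLFunction_one_nonneg`, Guo 1996 / Lapid–Rallis 2003). No further leaf is specific
  to the geometric-CM form.

The discharge `bsdTriple_of_hasCM_of_L_one_ne_zero_holds` is **not** asserted here.

## Design notes

* Pure compositions of theorems of the tree (kernel-reviewed); no `def`, no instance, no
  restatement. `noncomputable section`, assemblies in
  `namespace Literature.NumberTheory.EllipticCurves` next to the fact, as in the sibling files.

## References

* A. Burungale, M. Flach, *The conjecture of Birch and Swinnerton-Dyer for certain elliptic curves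
  with complex multiplication*, Camb. J. Math. 12 (2024), no. 2: Thm. 1.1, Cor. 1, Cor. 2 and the
  sentence following its proof (arXiv:2206.09874, pp. 3–4). [BurungaleFlach2024]
* J. W. S. Cassels, *Arithmetic on curves of genus 1. VIII*, J. reine angew. Math. 217 (1965).
  [Cassels1965ArithmeticVIII]
* J. S. Milne, *Arithmetic Duality Theorems*, 2nd ed. (2006), I.7: Thm. 7.3 (p. 97), Notes
  (p. 101). [MilneADT2006]
* J. H. Silverman, *The Arithmetic of Elliptic Curves*, 2nd ed. (2009), App. C §11,
  Examples 11.3.1–11.3.2. [SilvermanAEC2009]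
* J. H. Silverman, *Advanced Topics in the Arithmetic of Elliptic Curves* (1994), II Ex. 2.12(b).
  [SilvermanAdvancedTopics1994]
* K. Kato, Astérisque 295 (2004), Cor. 14.3. [Kato2004Asterisque]
-/

noncomputable section

namespace Literature.NumberTheory.EllipticCurves

open _root_.WeierstrassCurve

/-! ### From the verbatim form (CM by `𝓞_K`) and Cassels' theorem -/

/-- **bsd.S28, geometric-CM form, from the verbatim form and Cassels.** If the
Birch–Swinnerton-Dyer triple holds for every globally minimal `W/ℚ` with
`j(W) ∈ maximalCMJInvariants` and `L(W,1) ≠ 0` (`hA`, Burungale–Flach Cor. 2 over `ℚ` in the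
tree's normalisation), and the BSD quotient is a `ℚ`-isogeny invariant (`hISO`, Cassels 1965 /
Milne *ADT* I.7.3), then it holds for every globally minimal `W/ℚ` with geometric CM and
`L(W,1) ≠ 0`. This is `bsdTriple_of_hasCM_of_L_one_ne_zero_of_facts` with its other two leaves
discharged: Silverman *AT* Ex. 2.12(b)
(`exists_isIsogenous_j_mem_maximalCMJInvariants_of_hasCM_holds`, through the class number one
theorem) and Knapp 11.67 (`LFunction_eq_of_isIsogenous_holds`, inside
`bsdTriple_iff_of_isIsogenous_of_bsdRHS_eq_of_isIsogenous`).
[cite: BurungaleFlach2024, Cor. 2 and the sentence following its proof (arXiv p. 4)]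
[cite: MilneADT2006, Thm. I.7.3 (p. 97)] [cite: Cassels1965ArithmeticVIII] -/
theorem bsdTriple_of_hasCM_of_L_one_ne_zero_of_maximal_of_bsdRHS_eq_of_isIsogenous
    (hA : bsdTriple_of_j_mem_maximalCMJInvariants_of_L_one_ne_zero)
    (hISO : bsdRHS_eq_of_isIsogenous) : bsdTriple_of_hasCM_of_L_one_ne_zero :=
  bsdTriple_of_hasCM_of_L_one_ne_zero_of_facts hA
    exists_isIsogenous_j_mem_maximalCMJInvariants_of_hasCM_holds LFunction_eq_of_isIsogenous_holds
    (bsdTriple_iff_of_isIsogenous_of_bsdRHS_eq_of_isIsogenous hISO)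

/-- **Modulo Cassels' isogeny invariance, the two forms of bsd.S28 are equivalent**: the
geometric-CM form `bsdTriple_of_hasCM_of_L_one_ne_zero` and the verbatim maximal-order form
`bsdTriple_of_j_mem_maximalCMJInvariants_of_L_one_ne_zero`. Forward: a curve with
`j ∈ maximalCMJInvariants` has geometric CM (`hasCM_of_j_mem_maximalCMJInvariants_holds`,
Silverman *AEC* C.11.3.1); backward: the previous theorem.
[cite: BurungaleFlach2024, Cor. 2 and the sentence following its proof (arXiv p. 4)]
[cite: SilvermanAEC2009, App. C §11 Example 11.3.1] [cite: Cassels1965ArithmeticVIII] -/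
theorem bsdTriple_of_hasCM_of_L_one_ne_zero_iff_maximal_of_bsdRHS_eq_of_isIsogenous
    (hISO : bsdRHS_eq_of_isIsogenous) :
    bsdTriple_of_hasCM_of_L_one_ne_zero ↔
      bsdTriple_of_j_mem_maximalCMJInvariants_of_L_one_ne_zero :=
  ⟨fun h => bsdTriple_of_j_mem_maximalCMJInvariants_of_L_one_ne_zero_of_hasCM h
      hasCM_of_j_mem_maximalCMJInvariants_holds,
    fun hA => bsdTriple_of_hasCM_of_L_one_ne_zero_of_maximal_of_bsdRHS_eq_of_isIsogenous hA hISO⟩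

/-! ### From Corollary 2 over `ℚ` as printed and Cassels' theorem -/

/-- **bsd.S28, geometric-CM form, from two named facts**: Burungale–Flach's Corollary 2 over `ℚ`
as printed (`hBF` : `E(ℚ)`, `Ш` finite and `L(E,1)/Ω = #Ш/#E(ℚ)² · ∏ c_p` for CM by `𝓞_K` and
`L(E,1) ≠ 0`) and Cassels' quotient invariance (`hISO`). The sharpest assembly
`bsdTriple_of_hasCM_of_L_one_ne_zero_of_BurungaleFlach2024_of_j_mem_cmJInvariants_of_hasCM` with
its middle leaf discharged (`j_mem_cmJInvariants_of_hasCM_of_heegnerStarkPrime` at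
`HeegnerStarkPrimeThreeModEight_holds`, i.e. `j_mem_cmJInvariants_of_hasCM_holds`: Silverman
*AEC* C.11.3.1–3.2 through the class number one theorem, Baker's route). The discharge of bsd.S28 will be this
theorem at `BurungaleFlach2024_bsd_rat_holds` and `bsdRHS_eq_of_isIsogenous_holds`.
[cite: BurungaleFlach2024, Cor. 2 and the sentence following its proof (arXiv p. 4)]
[cite: Cassels1965ArithmeticVIII] [cite: SilvermanAEC2009, App. C §11, Example 11.3.1–11.3.2] -/
theorem bsdTriple_of_hasCM_of_L_one_ne_zero_of_BurungaleFlach2024_of_bsdRHS_eq_of_isIsogenous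
    (hBF : BurungaleFlach2024_bsd_rat) (hISO : bsdRHS_eq_of_isIsogenous) :
    bsdTriple_of_hasCM_of_L_one_ne_zero :=
  bsdTriple_of_hasCM_of_L_one_ne_zero_of_BurungaleFlach2024_of_j_mem_cmJInvariants_of_hasCM hBF
    (j_mem_cmJInvariants_of_hasCM_of_heegnerStarkPrime
      Literature.NumberTheory.QuadraticFields.BinaryQuadraticForm.HeegnerStarkPrimeThreeModEight_holds)
    hISO

/-! ### From the five primary leaves below Corollary 2 over `ℚ` -/

/-- **bsd.S28, geometric-CM form, from the five primary leaves of the cone**: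

1. `BurungaleFlach2024_main_cmField_pPart` (`hB`) — Burungale–Flach, Prop. 2.3 with Lemma 13 at
   `F = K` for every prime `p` (two-variable main conjecture, Thm. 4.1, and the reciprocity law,
   Prop. 3.1: the paper's contribution);
2. `kato_finite_of_L_one_ne_zero` for every elliptic `E/ℚ` and every prime (`hK`) — Kato,
   Astérisque 295, Cor. 14.3;
3. `bsdRHS_baseChange_quadratic` (`hBC`) — Milne 1972, Thm. 1, rank-zero quotient form;
4. `bsdRHS_eq_of_isIsogenous` (`hISO`) — Cassels 1965 / Milne *ADT* I.7.3;
5. `re_entireLFunction_one_nonneg` (`hPOS`) — `L(E,1) ≥ 0` (Guo 1996; Lapid–Rallis 2003, Thm. 1).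

The verbatim form from these five is
`bsdTriple_of_j_mem_maximalCMJInvariants_of_L_one_ne_zero_of_pPart_of_Kato`; the passage to
geometric CM costs nothing more (first theorem of this file, `hISO` again).
[cite: BurungaleFlach2024, Thm. 1.1 and its proof, Cor. 1, Cor. 2 (arXiv pp. 3–4, 22)]
[cite: Kato2004Asterisque, Cor. 14.3 (p. 235)] [cite: Cassels1965ArithmeticVIII] -/
theorem bsdTriple_of_hasCM_of_L_one_ne_zero_of_pPart_of_Kato
    (hB : BurungaleFlach2024_main_cmField_pPart)
    (hK : ∀ (W : WeierstrassCurve ℚ) [W.IsElliptic] (p : ℕ) [Fact p.Prime],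
      kato_finite_of_L_one_ne_zero W p)
    (hBC : bsdRHS_baseChange_quadratic) (hISO : bsdRHS_eq_of_isIsogenous)
    (hPOS : re_entireLFunction_one_nonneg) : bsdTriple_of_hasCM_of_L_one_ne_zero :=
  bsdTriple_of_hasCM_of_L_one_ne_zero_of_maximal_of_bsdRHS_eq_of_isIsogenous
    (bsdTriple_of_j_mem_maximalCMJInvariants_of_L_one_ne_zero_of_pPart_of_Kato hB hK hBC hISO hPOS)
    hISO

end Literature.NumberTheory.EllipticCurves

end
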